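import Literature.Probability.RandomPlanarGeometry.SAWIrreducibleBridgeCrossings
import Literature.Probability.RandomPlanarGeometry.SAWPulledLargeForceExpansionZdFirstOrder
import HarnessLib

/-!
# Irreducible bridges of `ℤ^{d+1}` of span `A` and length `3A + 2`: exactly four transverse steps, two regimes

Topic `Literature/Probability/RandomPlanarGeometry` (continues `SAWIrreducibleBridgeThreeSpan.lean` — `3A ≤ k` —, the extremal case
`k = 3A` (`…ThreeSpanExtremal.lean`) and the one-slack case `k = 3A + 1` (`…ThreeSpanSlack.lean`); Madras–Slade §4.2, p. 94).

TWO SLACKS. If `k = 3A + 2` (`A ≥ 2`) the three-span count leaves room for two more non-crossing steps. THEOREM: such a bridge has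
EXACTLY FOUR transverse steps (the set `F` of flat times has four elements), and its height word is one of two kinds:
* regime (i) «staple with two free plateaus»: `ω₀(t) = stapleR A (t − #{f ∈ F : f < t})`, the reduced staple word
  `0,1,…,A,A−1,…,1,2,…,A` (`U^A D^{A−1} U^{A−1}`) read at the reduced position `t − #(flats before t)`; two of the four flats sit at the
  reduced positions `A` (the peak turn) and `2A − 1` (the valley turn), the other two are anywhere in `[1, 3A−2]`;
* regime (ii) «one extra bump»: for some `2 ≤ P ≤ A − 1` the flats are exactly `{P, 2P, 2P + A, P + 2A + 1}` and
  `ω₀(t) = bumpR A P (t − #{f ∈ F : f < t})`, the reduced word `U^P D^{P−1} U^{A−1} D^{A−P} U^{A−P}` — the four flats are its four turns.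
Ingredients: the crossing count of the three-span lemma (gap `0` once, every internal gap thrice ⇒ at most four flat steps),
self-avoidance (no `±e₀, ∓e₀` pairs ⇒ monotone vertical runs between flats; a direction change costs a flat), and the arithmetic
`k = 3A + 2` (which forces four flats, peak `A`, valley `1` in regime (i); in regime (ii) the two descents cover every level once).
Irreducibility enters only through the crossing count. The sequel counts the bridges (fibres of the height words).

## Contents (namespace `Literature.Probability.RandomPlanarGeometry.SAW.Zd`)
`stapleR`, `bumpR` (ℕ tables), `flatTimes`; ★★ `card_flatTimes_eq_four_and_heights_of_length_eq_three_mul_span_add_two`.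
Lane «pcv-sawmu» (a-p3 g17, 2026-08-25). [cite: MadrasSlade1993, §4.2, remark after Theorem 4.2.4 (p. 94)] [cite: DuminilCopinHammond2013, §2.2]
-/

noncomputable section

open Finset Literature.Probability.LatticeModels SimpleGraph
open scoped BigOperators
open Literature.Probability.RandomPlanarGeometry.SAW

namespace Literature.Probability.RandomPlanarGeometry.SAW.Zd

/-- The reduced staple word `U^A D^{A−1} U^{A−1}` (heights at reduced position `j`): `j` (`j ≤ A`), `2A − j` (`A ≤ j ≤ 2A − 1`),
`j + 2 − 2A` (`j ≥ 2A − 1`). [cite: MadrasSlade1993, §4.2, remark after Theorem 4.2.4 (p. 94)] -/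
def stapleR (A j : ℕ) : ℕ := if j ≤ A then j else if j ≤ 2 * A - 1 then 2 * A - j else j + 2 - 2 * A

/-- The reduced bump word `U^P D^{P−1} U^{A−1} D^{A−P} U^{A−P}` (heights at reduced position `j`).
[cite: MadrasSlade1993, §4.2, remark after Theorem 4.2.4 (p. 94)] -/
def bumpR (A P j : ℕ) : ℕ :=
  if j ≤ P then j else if j ≤ 2 * P - 1 then 2 * P - j else if j ≤ 2 * P + A - 2 then j + 2 - 2 * P
  else if j ≤ P + 2 * A - 2 then 2 * P + 2 * A - 2 - j else j + 2 - 2 * A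

/-- The flat (transverse) times of a `k`-step walk: `t < k` with `ω₀(t + 1) = ω₀(t)`. [cite: MadrasSlade1993, §4.2, remark after Theorem 4.2.4 (p. 94)] -/
def flatTimes {d : ℕ} (k : ℕ) (ω : ℕ → Site (d + 1)) : Finset ℕ := (range k).filter fun t => ω (t + 1) 0 = ω t 0

/-! ### Counting flats before a time -/

/-- One more time step adds the indicator of a flat. [folklore] -/
private theorem card_filter_lt_succ (F : Finset ℕ) (t : ℕ) :
    (((F.filter (· < t + 1)).card : ℕ) : ℤ) = ((F.filter (· < t)).card : ℕ) + if t ∈ F then 1 else 0 := by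
  classical
  have hsplit : F.filter (· < t + 1) = F.filter (· < t) ∪ F.filter (· = t) := by
    ext x; simp only [Finset.mem_filter, Finset.mem_union]
    constructor
    · rintro ⟨hx, hlt⟩
      by_cases hxt : x = t
      · exact Or.inr ⟨hx, hxt⟩
      · exact Or.inl ⟨hx, by omega⟩
    · rintro (⟨hx, hlt⟩ | ⟨hx, hxt⟩)
      · exact ⟨hx, by omega⟩
      · exact ⟨hx, by omega⟩
  have hdisj : Disjoint (F.filter (· < t)) (F.filter (· = t)) := by
    rw [Finset.disjoint_left]; intro x hx hx'
    simp only [Finset.mem_filter] at hx hx'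
    have h1 := hx.2; have h2 := hx'.2; omega
  rw [hsplit, Finset.card_union_of_disjoint hdisj, Finset.filter_eq' F t]
  by_cases ht : t ∈ F
  · rw [if_pos ht, if_pos ht, Finset.card_singleton]; push_cast; ring
  · rw [if_neg ht, if_neg ht, Finset.card_empty]; push_cast; ring

/-- At most one flat per time step: `#{f ∈ F : f < t} − #{f ∈ F : f < s} ≤ t − s`. [folklore] -/
private theorem card_filter_lt_mono (F : Finset ℕ) {s t : ℕ} (hst : s ≤ t) :
    (F.filter (· < t)).card ≤ (F.filter (· < s)).card + (t - s) ∧ (F.filter (· < s)).card ≤ (F.filter (· < t)).card := by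
  classical
  constructor
  · have hsub : F.filter (· < t) ⊆ F.filter (· < s) ∪ Finset.Ico s t := by
      intro x hx
      simp only [Finset.mem_filter, Finset.mem_union, Finset.mem_Ico] at hx ⊢
      rcases Nat.lt_or_ge x s with h' | h'
      · exact Or.inl ⟨hx.1, h'⟩
      · exact Or.inr ⟨h', hx.2⟩
    calc (F.filter (· < t)).card ≤ (F.filter (· < s) ∪ Finset.Ico s t).card := Finset.card_le_card hsub
      _ ≤ (F.filter (· < s)).card + (Finset.Ico s t).card := Finset.card_union_le _ _
      _ = (F.filter (· < s)).card + (t - s) := by rw [Nat.card_Ico]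
  · exact Finset.card_le_card (fun x hx => by simp only [Finset.mem_filter] at hx ⊢; exact ⟨hx.1, by omega⟩)

/-- All flats are before `k` when `F ⊆ range k`. [folklore] -/
private theorem card_filter_lt_of_subset_range {F : Finset ℕ} {k : ℕ} (hF : F ⊆ range k) : (F.filter (· < k)).card = F.card := by
  congr 1; exact Finset.filter_true_of_mem fun x hx => Finset.mem_range.1 (hF hx)

/-- The tables over `ℤ`. [cite: MadrasSlade1993, §4.2, remark after Theorem 4.2.4 (p. 94)] -/
private theorem stapleR_cast (A j : ℕ) : ((stapleR A j : ℕ) : ℤ) =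
    if j ≤ A then (j : ℤ) else if j ≤ 2 * A - 1 then 2 * (A : ℤ) - j else (j : ℤ) + 2 - 2 * A := by
  simp only [stapleR]; split_ifs <;> omega

/-- The tables over `ℤ`. [cite: MadrasSlade1993, §4.2, remark after Theorem 4.2.4 (p. 94)] -/
private theorem bumpR_cast (A P j : ℕ) (hP : 2 ≤ P) (hPA : P + 1 ≤ A) : ((bumpR A P j : ℕ) : ℤ) =
    if j ≤ P then (j : ℤ) else if j ≤ 2 * P - 1 then 2 * (P : ℤ) - j else if j ≤ 2 * P + A - 2 then (j : ℤ) + 2 - 2 * P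
    else if j ≤ P + 2 * A - 2 then 2 * (P : ℤ) + 2 * A - 2 - j else (j : ℤ) + 2 - 2 * A := by
  simp only [bumpR]; split_ifs <;> omega

/-! ### A vertical run keeps its direction (self-avoidance: no `−e₀` right after `+e₀` and vice versa) -/

/-- If the steps `a, …, b` are all vertical, step `a` is down, and «down then up» never happens, they are all down. [folklore] -/
private theorem down_run {h : ℕ → ℤ} {a b : ℕ}
    (hv : ∀ t, a ≤ t → t ≤ b → h (t + 1) = h t + 1 ∨ h (t + 1) = h t - 1)
    (no_du : ∀ t, a ≤ t → t < b → h (t + 1) = h t - 1 → h (t + 2) = h (t + 1) + 1 → False)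
    (ha : h (a + 1) = h a - 1) : ∀ t, a ≤ t → t ≤ b → h (t + 1) = h t - 1 := by
  intro t hat htb
  induction t with
  | zero =>
    have : a = 0 := by omega
    subst this; exact ha
  | succ t ih =>
    rcases Nat.lt_or_ge t a with hlt | hge
    · have : a = t + 1 := by omega
      subst this; exact ha
    · have hprev := ih hge (by omega)
      rcases hv (t + 1) hat htb with hup | hdown
      · exact (no_du t hge (by omega) hprev (by rw [show t + 2 = t + 1 + 1 by ring]; exact hup)).elim
      · exact hdown

/-! ### Regime (i): the arithmetic of «staple with free plateaus» -/

/-- **Regime (i), abstract form.** Three monotone runs up/down/up broken only by flat steps (a set `F ⊆ [0,k)` of at most four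
times, containing the two turn plateaus `τ₁` and `tM + 1`), start `0`, end `A ≤` peak-bound, valley `≥ 1`, and `k = 3A + 2` force:
exactly four flats, and the height at time `t` is the reduced staple word at `t − #{f ∈ F : f < t}`; the turn plateaus sit at the
reduced positions `A` and `2A − 1`. [cite: MadrasSlade1993, §4.2, remark after Theorem 4.2.4 (p. 94)] -/
private theorem regime_one {h : ℕ → ℤ} {A k τ₁ tM : ℕ} {F : Finset ℕ} (hA2 : 2 ≤ A) (hk : k = 3 * A + 2)
    (hFsub : F ⊆ range k) (hFcard : F.card ≤ 4) (hτ₁F : τ₁ ∈ F) (hτ₂F : tM + 1 ∈ F) (hlt : τ₁ < tM) (htMk : tM + 2 ≤ k)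
    (hflat : ∀ t, t ∈ F → h (t + 1) = h t)
    (hr1 : ∀ t, t ≤ τ₁ → t ∉ F → h (t + 1) = h t + 1)
    (hr2 : ∀ t, τ₁ + 1 ≤ t → t ≤ tM → t ∉ F → h (t + 1) = h t - 1)
    (hr3 : ∀ t, tM + 1 ≤ t → t < k → t ∉ F → h (t + 1) = h t + 1)
    (h0 : h 0 = 0) (hAk : h k = A) (hpk : h τ₁ ≤ A) (hval : 1 ≤ h (tM + 1)) :
    F.card = 4 ∧ (∀ t, t ≤ k → h t = stapleR A (t - (F.filter (· < t)).card)) ∧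
      (τ₁ : ℤ) = A + ((F.filter (· < τ₁)).card : ℕ) ∧ (tM : ℤ) + 1 = 2 * A - 1 + ((F.filter (· < tM + 1)).card : ℕ) := by
  classical
  -- the counting function and the reduced position
  set c : ℕ → ℤ := fun t => ((F.filter (· < t)).card : ℕ) with hc
  have hc_succ : ∀ t, c (t + 1) = c t + if t ∈ F then 1 else 0 := fun t => card_filter_lt_succ F t
  have hc0 : c 0 = 0 := by simp [hc]
  have hck : c k = F.card := by simp only [hc]; rw [card_filter_lt_of_subset_range hFsub]
  -- peak `p` and valley position `jv`
  set p : ℤ := (τ₁ : ℤ) - c τ₁ with hp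
  set jv : ℤ := (tM : ℤ) + 1 - c (tM + 1) with hjv
  have hcτ₁ : c (τ₁ + 1) = c τ₁ + 1 := by rw [hc_succ, if_pos hτ₁F]
  have hcτ₂ : c (tM + 2) = c (tM + 1) + 1 := by rw [show tM + 2 = tM + 1 + 1 by ring, hc_succ, if_pos hτ₂F]
  -- the height formula, by induction on `t`
  have H : ∀ t, t ≤ k → h t = if t ≤ τ₁ + 1 then (t : ℤ) - c t else if t ≤ tM + 1 then 2 * p - ((t : ℤ) - c t)
      else ((t : ℤ) - c t) + 2 * p - 2 * jv := by
    intro t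
    induction t with
    | zero => intro _; rw [if_pos (by omega), h0, hc0]; simp
    | succ t ih =>
      intro ht
      have hprev := ih (by omega)
      have hct := hc_succ t
      rcases Nat.lt_trichotomy t (τ₁ + 1) with hlt1 | heq1 | hgt1
      · -- inside run 1
        rw [if_pos (by omega)] at hprev
        rw [if_pos (by omega)]
        by_cases htF : t ∈ F
        · rw [hflat t htF, hprev, hct, if_pos htF]; push_cast; ring
        · rw [hr1 t (by omega) htF, hprev, hct, if_neg htF]; push_cast; ring
      · -- `t = τ₁ + 1`: the boundary between run 1 and run 2
        subst heq1
        rw [if_pos le_rfl] at hprev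
        rw [if_neg (by omega), if_pos (by omega)]
        by_cases htF : τ₁ + 1 ∈ F
        · rw [hflat _ htF, hprev, hct, if_pos htF, hcτ₁, hp]; push_cast; ring
        · rw [hr2 (τ₁ + 1) le_rfl (by omega) htF, hprev, hct, if_neg htF, hcτ₁, hp]; push_cast; ring
      · rcases Nat.lt_trichotomy t (tM + 1) with hlt2 | heq2 | hgt2
        · -- inside run 2
          rw [if_neg (by omega), if_pos (by omega)] at hprev
          rw [if_neg (by omega), if_pos (by omega)]
          by_cases htF : t ∈ F
          · rw [hflat t htF, hprev, hct, if_pos htF]; push_cast; ring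
          · rw [hr2 t (by omega) (by omega) htF, hprev, hct, if_neg htF]; push_cast; ring
        · -- `t = tM + 1`: the valley plateau
          subst heq2
          rw [if_neg (by omega), if_pos le_rfl] at hprev
          rw [if_neg (by omega), if_neg (by omega), hflat _ hτ₂F, hprev, hct, if_pos hτ₂F, hjv]; push_cast; ring
        · -- inside run 3
          rw [if_neg (by omega), if_neg (by omega)] at hprev
          rw [if_neg (by omega), if_neg (by omega)]
          by_cases htF : t ∈ F
          · rw [hflat t htF, hprev, hct, if_pos htF]; push_cast; ring
          · rw [hr3 t (by omega) (by omega) htF, hprev, hct, if_neg htF]; push_cast; ring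
  -- evaluate at `τ₁`, `tM + 1`, `k`
  have hpeak : h τ₁ = p := by rw [H τ₁ (by omega), if_pos (by omega)]
  have hvalley : h (tM + 1) = 2 * p - jv := by
    rw [H (tM + 1) (by omega), if_neg (by omega), if_pos le_rfl, hjv]; push_cast; ring
  have hend : (A : ℤ) = ((k : ℤ) - F.card) + 2 * p - 2 * jv := by rw [← hAk, H k le_rfl, if_neg (by omega), if_neg (by omega), hck]
  -- monotonicity of the reduced position: `c t − c s ≤ t − s`
  have hmono : ∀ s t, s ≤ t → c t ≤ c s + ((t : ℤ) - s) ∧ c s ≤ c t := by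
    intro s t hst
    obtain ⟨h1', h2'⟩ := card_filter_lt_mono F hst
    refine ⟨?_, ?_⟩
    · show ((F.filter (· < t)).card : ℤ) ≤ ((F.filter (· < s)).card : ℤ) + ((t : ℤ) - s)
      have : ((F.filter (· < t)).card : ℤ) ≤ ((F.filter (· < s)).card : ℤ) + ((t - s : ℕ) : ℤ) := by exact_mod_cast h1'
      rw [Nat.cast_sub hst] at this; exact this
    · show ((F.filter (· < s)).card : ℤ) ≤ ((F.filter (· < t)).card : ℤ)
      exact_mod_cast h2'
  -- the descent has `jv − p` vertical steps and drops from `p` to the valley `2p − jv`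
  have hFc : (F.card : ℤ) ≤ 4 := by exact_mod_cast hFcard
  have hk' : (k : ℤ) = 3 * A + 2 := by rw [hk]; push_cast; ring
  have hdesc : jv - p ≤ (A : ℤ) - 1 := by rw [hvalley] at hval; rw [hpeak] at hpk; linarith
  -- CONCLUSION of the arithmetic: `|F| = 4`, `p = A`, `jv = 2A − 1`
  have hF4 : (F.card : ℤ) = 4 := by linarith
  have hpA : p = A := by rw [hpeak] at hpk; linarith
  have hjvA : jv = 2 * A - 1 := by linarith
  refine ⟨by exact_mod_cast hF4, fun t ht => ?_, by rw [hp] at hpA; linarith, by rw [hjv] at hjvA; linarith⟩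
  -- the word
  have hj_le1 : ∀ t, t ≤ τ₁ + 1 → (t : ℤ) - c t ≤ A := by
    intro t ht1
    have := (hmono t (τ₁ + 1) ht1).1
    rw [hcτ₁] at this
    have hp' : (τ₁ : ℤ) - c τ₁ = A := by rw [hp] at hpA; exact hpA
    push_cast at this; linarith
  have hj_ge2 : ∀ t, τ₁ + 1 ≤ t → (A : ℤ) ≤ (t : ℤ) - c t := by
    intro t ht1
    have := (hmono (τ₁ + 1) t ht1).1
    rw [hcτ₁] at this
    have hp' : (τ₁ : ℤ) - c τ₁ = A := by rw [hp] at hpA; exact hpA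
    push_cast at this; linarith
  have hj_le2 : ∀ t, t ≤ tM + 1 → (t : ℤ) - c t ≤ 2 * A - 1 := by
    intro t ht1
    have := (hmono t (tM + 1) ht1).1
    have hv' : (tM : ℤ) + 1 - c (tM + 1) = 2 * A - 1 := by rw [hjv] at hjvA; exact hjvA
    push_cast at this; linarith
  have hj_ge3 : ∀ t, tM + 2 ≤ t → 2 * (A : ℤ) - 1 ≤ (t : ℤ) - c t := by
    intro t ht1
    have := (hmono (tM + 2) t ht1).1
    rw [hcτ₂] at this
    have hv' : (tM : ℤ) + 1 - c (tM + 1) = 2 * A - 1 := by rw [hjv] at hjvA; exact hjvA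
    push_cast at this; linarith
  have hcnat : ((t - (F.filter (· < t)).card : ℕ) : ℤ) = (t : ℤ) - c t := by
    have : (F.filter (· < t)).card ≤ t := by
      have h' := (card_filter_lt_mono F (Nat.zero_le t)).1
      simpa using h'
    rw [Nat.cast_sub this]
  rw [H t ht, stapleR_cast, hcnat, hpA, hjvA]
  by_cases h1 : t ≤ τ₁ + 1
  · have := hj_le1 t h1
    rw [if_pos h1]; split_ifs <;> omega
  rw [if_neg h1]
  by_cases h2 : t ≤ tM + 1
  · have e1 := hj_ge2 t (by omega); have e2 := hj_le2 t h2
    rw [if_pos h2]; split_ifs <;> omega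
  · have e1 := hj_ge3 t (by omega)
    rw [if_neg h2]; split_ifs <;> omega


/-! ### Regime (ii): the arithmetic of «one extra bump» -/

/-- Flats of an explicit four-element set before time `t`. [folklore] -/
private theorem card_filter_lt_four {a b c e : ℕ} (hab : a < b) (hbc : b < c) (hce : c < e) (t : ℕ) :
    (((({a, b, c, e} : Finset ℕ).filter (· < t)).card : ℕ) : ℤ) =
      (if a < t then 1 else 0) + (if b < t then 1 else 0) + (if c < t then 1 else 0) + (if e < t then 1 else 0) := by
  classical
  induction t with
  | zero => simp
  | succ t ih =>
    rw [card_filter_lt_succ, ih]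
    simp only [Finset.mem_insert, Finset.mem_singleton]
    by_cases h1 : t = a
    · subst h1; rw [if_pos (Or.inl rfl)]; split_ifs <;> omega
    by_cases h2 : t = b
    · subst h2; rw [if_pos (Or.inr (Or.inl rfl))]; split_ifs <;> omega
    by_cases h3 : t = c
    · subst h3; rw [if_pos (Or.inr (Or.inr (Or.inl rfl)))]; split_ifs <;> omega
    by_cases h4 : t = e
    · subst h4; rw [if_pos (Or.inr (Or.inr (Or.inr rfl)))]; split_ifs <;> omega
    have hnot : ¬ (t = a ∨ t = b ∨ t = c ∨ t = e) := by
      rintro (h' | h' | h' | h')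
      · exact h1 h'
      · exact h2 h'
      · exact h3 h'
      · exact h4 h'
    rw [if_neg hnot]
    have h1' : t ≠ a := h1
    have h2' : t ≠ b := h2
    have h3' : t ≠ c := h3
    have h4' : t ≠ e := h4
    split_ifs <;> omega

/-- **Regime (ii), abstract form.** Five monotone runs up/down/up/down/up separated by exactly four flats `τ₁ < φ₁ < φ₂ < tM + 1`
(all runs but the last nonempty), start `0`, heights in `[1, A]`, end `A`, every level `1 ≤ g ≤ A − 1` stepped down onto at least
once, and `k = 3A + 2` force: `P := τ₁ ∈ [2, A − 1]`, flats `{P, 2P, 2P + A, P + 2A + 1}`, heights = the reduced bump word.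
[cite: MadrasSlade1993, §4.2, remark after Theorem 4.2.4 (p. 94)] -/
private theorem regime_two {h : ℕ → ℤ} {A k τ₁ φ₁ φ₂ tM : ℕ} {F : Finset ℕ} (hk : k = 3 * A + 2)
    (hFeq : F = {τ₁, φ₁, φ₂, tM + 1}) (h12 : τ₁ + 2 ≤ φ₁) (h23 : φ₁ + 2 ≤ φ₂) (h34 : φ₂ + 1 ≤ tM) (htMk : tM + 2 ≤ k)
    (hflat : ∀ t, t ∈ F → h (t + 1) = h t)
    (hr1 : ∀ t, t < τ₁ → h (t + 1) = h t + 1)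
    (hr2 : ∀ t, τ₁ < t → t < φ₁ → h (t + 1) = h t - 1)
    (hr3 : ∀ t, φ₁ < t → t < φ₂ → h (t + 1) = h t + 1)
    (hr4 : ∀ t, φ₂ < t → t ≤ tM → h (t + 1) = h t - 1)
    (hr5 : ∀ t, tM + 1 < t → t < k → h (t + 1) = h t + 1)
    (h0 : h 0 = 0) (hAk : h k = A) (hpos : ∀ t, 1 ≤ t → t ≤ k → 1 ≤ h t ∧ h t ≤ A)
    (hcov : ∀ g : ℤ, 1 ≤ g → g + 1 ≤ A → ∃ t, t < k ∧ h t = g + 1 ∧ h (t + 1) = g) :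
    2 ≤ τ₁ ∧ τ₁ + 1 ≤ A ∧ F = {τ₁, 2 * τ₁, 2 * τ₁ + A, τ₁ + 2 * A + 1} ∧
      ∀ t, t ≤ k → h t = bumpR A τ₁ (t - (F.filter (· < t)).card) := by
  classical
  have hτ₁F : τ₁ ∈ F := by rw [hFeq]; simp
  have hφ₁F : φ₁ ∈ F := by rw [hFeq]; simp
  have hφ₂F : φ₂ ∈ F := by rw [hFeq]; simp
  have hτ₂F : tM + 1 ∈ F := by rw [hFeq]; simp
  -- the height formula
  have H : ∀ t, t ≤ k → h t = if t ≤ τ₁ then (t : ℤ) else if t ≤ φ₁ then 2 * (τ₁ : ℤ) + 1 - t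
      else if t ≤ φ₂ then (t : ℤ) + 2 * τ₁ - 2 * φ₁ else if t ≤ tM + 1 then 2 * (τ₁ : ℤ) - 2 * φ₁ + 2 * φ₂ + 1 - t
      else (t : ℤ) + 2 * τ₁ - 2 * φ₁ + 2 * φ₂ - 2 * tM - 2 := by
    intro t
    induction t with
    | zero => intro _; rw [if_pos (Nat.zero_le _), h0]; simp
    | succ t ih =>
      intro ht
      have hprev := ih (by omega)
      rcases Nat.lt_trichotomy t τ₁ with hlt1 | rfl | hgt1
      · rw [if_pos (by omega)] at hprev
        rw [if_pos (by omega), hr1 t hlt1, hprev]; push_cast; ring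
      · rw [if_pos le_rfl] at hprev
        rw [if_neg (by omega), if_pos (by omega), hflat _ hτ₁F, hprev]; push_cast; ring
      rcases Nat.lt_trichotomy t φ₁ with hlt2 | rfl | hgt2
      · rw [if_neg (by omega), if_pos (by omega)] at hprev
        rw [if_neg (by omega), if_pos (by omega), hr2 t hgt1 hlt2, hprev]; push_cast; ring
      · rw [if_neg (by omega), if_pos le_rfl] at hprev
        rw [if_neg (by omega), if_neg (by omega), if_pos (by omega), hflat _ hφ₁F, hprev]; push_cast; ring
      rcases Nat.lt_trichotomy t φ₂ with hlt3 | rfl | hgt3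
      · rw [if_neg (by omega), if_neg (by omega), if_pos (by omega)] at hprev
        rw [if_neg (by omega), if_neg (by omega), if_pos (by omega), hr3 t hgt2 hlt3, hprev]; push_cast; ring
      · rw [if_neg (by omega), if_neg (by omega), if_pos le_rfl] at hprev
        rw [if_neg (by omega), if_neg (by omega), if_neg (by omega), if_pos (by omega), hflat _ hφ₂F, hprev]; push_cast; ring
      rcases Nat.lt_trichotomy t (tM + 1) with hlt4 | rfl | hgt4
      · rw [if_neg (by omega), if_neg (by omega), if_neg (by omega), if_pos (by omega)] at hprev
        rw [if_neg (by omega), if_neg (by omega), if_neg (by omega), if_pos (by omega), hr4 t hgt3 (by omega), hprev]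
        push_cast; ring
      · rw [if_neg (by omega), if_neg (by omega), if_neg (by omega), if_pos le_rfl] at hprev
        rw [if_neg (by omega), if_neg (by omega), if_neg (by omega), if_neg (by omega), hflat _ hτ₂F, hprev]; push_cast; ring
      · rw [if_neg (by omega), if_neg (by omega), if_neg (by omega), if_neg (by omega)] at hprev
        rw [if_neg (by omega), if_neg (by omega), if_neg (by omega), if_neg (by omega), hr5 t hgt4 (by omega), hprev]
        push_cast; ring
  -- where the down-steps are, and the levels they serve
  have hdown : ∀ t, t < k → h (t + 1) = h t - 1 → (τ₁ < t ∧ t < φ₁) ∨ (φ₂ < t ∧ t ≤ tM) := by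
    intro t htk hd
    rcases Nat.lt_trichotomy t τ₁ with hlt1 | rfl | hgt1
    · have := hr1 t hlt1; omega
    · have := hflat _ hτ₁F; omega
    rcases Nat.lt_trichotomy t φ₁ with hlt2 | rfl | hgt2
    · exact Or.inl ⟨hgt1, hlt2⟩
    · have := hflat _ hφ₁F; omega
    rcases Nat.lt_trichotomy t φ₂ with hlt3 | rfl | hgt3
    · have := hr3 t hgt2 hlt3; omega
    · have := hflat _ hφ₂F; omega
    rcases Nat.lt_trichotomy t (tM + 1) with hlt4 | rfl | hgt4
    · exact Or.inr ⟨hgt3, by omega⟩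
    · have := hflat _ hτ₂F; omega
    · have := hr5 t hgt4 htk; omega
  have hlevel : ∀ g : ℤ, 1 ≤ g → g + 1 ≤ A →
      (2 * (τ₁ : ℤ) + 1 - φ₁ ≤ g ∧ g + 1 ≤ τ₁) ∨ (2 * (τ₁ : ℤ) - 2 * φ₁ + 2 * φ₂ - tM ≤ g ∧ g + 1 ≤ 2 * (τ₁ : ℤ) - 2 * φ₁ + φ₂) := by
    intro g hg1 hgA
    obtain ⟨t, htk, htg, htg'⟩ := hcov g hg1 hgA
    have e := H (t + 1) (by omega)
    rcases hdown t htk (by rw [htg, htg']; ring) with ⟨h1, h2⟩ | ⟨h1, h2⟩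
    · rw [if_neg (by omega), if_pos (by omega)] at e
      left; rw [htg'] at e; constructor <;> push_cast at e <;> omega
    · rw [if_neg (by omega), if_neg (by omega), if_neg (by omega), if_pos (by omega)] at e
      right; rw [htg'] at e; constructor <;> push_cast at e <;> omega
  -- the values at the turns and at the end
  have hv1 := (hpos φ₁ (by omega) (by omega)).1
  have hp2 := (hpos φ₂ (by omega) (by omega)).2
  have ev1 : h φ₁ = 2 * (τ₁ : ℤ) + 1 - φ₁ := by rw [H φ₁ (by omega), if_neg (by omega), if_pos le_rfl]
  have ep2 : h φ₂ = (φ₂ : ℤ) + 2 * τ₁ - 2 * φ₁ := by rw [H φ₂ (by omega), if_neg (by omega), if_neg (by omega), if_pos le_rfl]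
  have eA : (A : ℤ) = (k : ℤ) + 2 * τ₁ - 2 * φ₁ + 2 * φ₂ - 2 * tM - 2 := by
    rw [← hAk, H k le_rfl, if_neg (by omega), if_neg (by omega), if_neg (by omega), if_neg (by omega)]
  rw [ev1] at hv1
  rw [ep2] at hp2
  have hk' : (k : ℤ) = 3 * A + 2 := by rw [hk]; push_cast; ring
  -- coverage at the three decisive levels
  have c1 := hlevel 1 le_rfl (by omega)
  have cA := hlevel ((A : ℤ) - 1) (by omega) (by omega)
  have cP : (τ₁ : ℤ) + 1 ≤ A → (2 * (τ₁ : ℤ) + 1 - φ₁ ≤ τ₁ ∧ (τ₁ : ℤ) + 1 ≤ τ₁) ∨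
      (2 * (τ₁ : ℤ) - 2 * φ₁ + 2 * φ₂ - tM ≤ τ₁ ∧ (τ₁ : ℤ) + 1 ≤ 2 * (τ₁ : ℤ) - 2 * φ₁ + φ₂) :=
    fun hle => hlevel τ₁ (by omega) hle
  -- the arithmetic conclusion
  have hφ₁ : (φ₁ : ℤ) = 2 * τ₁ := by omega
  have hφ₂ : (φ₂ : ℤ) = 2 * τ₁ + A := by omega
  have htM : (tM : ℤ) = τ₁ + 2 * A := by omega
  have hP2 : 2 ≤ τ₁ := by omega
  have hPA : τ₁ + 1 ≤ A := by omega
  have hφ₁n : φ₁ = 2 * τ₁ := by exact_mod_cast hφ₁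
  have hφ₂n : φ₂ = 2 * τ₁ + A := by exact_mod_cast hφ₂
  have htMn : tM + 1 = τ₁ + 2 * A + 1 := by
    have e : (tM : ℤ) + 1 = τ₁ + 2 * A + 1 := by omega
    exact_mod_cast e
  have hFeq' : F = {τ₁, 2 * τ₁, 2 * τ₁ + A, τ₁ + 2 * A + 1} := by rw [hFeq, hφ₁n, hφ₂n, htMn]
  refine ⟨hP2, hPA, hFeq', fun t ht => ?_⟩
  -- the word
  have hc := card_filter_lt_four (a := τ₁) (b := 2 * τ₁) (c := 2 * τ₁ + A) (e := τ₁ + 2 * A + 1)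
    (by omega) (by omega) (by omega) t
  rw [← hFeq'] at hc
  have hcle : (F.filter (· < t)).card ≤ t := by
    have h' := (card_filter_lt_mono F (Nat.zero_le t)).1
    simpa using h'
  have hcnat : ((t - (F.filter (· < t)).card : ℕ) : ℤ) = (t : ℤ) - ((F.filter (· < t)).card : ℕ) := by
    rw [Nat.cast_sub hcle]
  rw [H t ht, bumpR_cast A τ₁ _ hP2 hPA]
  rcases Nat.lt_or_ge τ₁ t with h1 | h1
  swap
  · rw [if_neg (by omega), if_neg (by omega), if_neg (by omega), if_neg (by omega)] at hc
    have hj : ((t - (F.filter (· < t)).card : ℕ) : ℤ) = t := by rw [hcnat]; linarith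
    have hjn : t - (F.filter (· < t)).card = t := by exact_mod_cast hj
    rw [if_pos h1, hjn, if_pos h1]
  rcases Nat.lt_or_ge (2 * τ₁) t with h2 | h2
  swap
  · rw [if_pos h1, if_neg (by omega), if_neg (by omega), if_neg (by omega)] at hc
    have hj : ((t - (F.filter (· < t)).card : ℕ) : ℤ) = t - 1 := by rw [hcnat]; linarith
    have hjn : t - (F.filter (· < t)).card = t - 1 := by omega
    rw [if_neg (by omega), if_pos (by omega), hjn]; split_ifs <;> omega
  rcases Nat.lt_or_ge (2 * τ₁ + A) t with h3 | h3
  swap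
  · rw [if_pos h1, if_pos h2, if_neg (by omega), if_neg (by omega)] at hc
    have hj : ((t - (F.filter (· < t)).card : ℕ) : ℤ) = t - 2 := by rw [hcnat]; linarith
    have hjn : t - (F.filter (· < t)).card = t - 2 := by omega
    rw [if_neg (by omega), if_neg (by omega), if_pos (by omega), hjn]; split_ifs <;> omega
  rcases Nat.lt_or_ge (τ₁ + 2 * A + 1) t with h4 | h4
  swap
  · rw [if_pos h1, if_pos h2, if_pos h3, if_neg (by omega)] at hc
    have hj : ((t - (F.filter (· < t)).card : ℕ) : ℤ) = t - 3 := by rw [hcnat]; linarith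
    have hjn : t - (F.filter (· < t)).card = t - 3 := by omega
    rw [if_neg (by omega), if_neg (by omega), if_neg (by omega), if_pos (by omega), hjn]; split_ifs <;> omega
  · rw [if_pos h1, if_pos h2, if_pos h3, if_pos h4] at hc
    have hj : ((t - (F.filter (· < t)).card : ℕ) : ℤ) = t - 4 := by rw [hcnat]; linarith
    have hjn : t - (F.filter (· < t)).card = t - 4 := by omega
    rw [if_neg (by omega), if_neg (by omega), if_neg (by omega), if_neg (by omega), hjn]; split_ifs <;> omega


/-! ### Discrete intermediate-value steps (copies of the private helpers of the three-span files) -/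

/-- First up-crossing of the gap `{g, g+1}` after `t₀` (±1-Lipschitz integer sequence). [folklore] -/
private theorem upcrossTw {h : ℕ → ℤ} {k : ℕ} (hstep : ∀ t, t < k → |h (t + 1) - h t| ≤ 1)
    {t₀ s₁ : ℕ} {g : ℤ} (h01 : t₀ ≤ s₁) (hs₁ : s₁ ≤ k) (hlo : h t₀ ≤ g) (hhi : g + 1 ≤ h s₁) :
    ∃ t, t₀ ≤ t ∧ t < s₁ ∧ h t = g ∧ h (t + 1) = g + 1 := by
  classical
  have hex : ∃ s, t₀ ≤ s ∧ s ≤ s₁ ∧ g + 1 ≤ h s := ⟨s₁, h01, le_rfl, hhi⟩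
  obtain ⟨s, ⟨hs0, hss₁, hsg⟩, hmin⟩ : ∃ s, (t₀ ≤ s ∧ s ≤ s₁ ∧ g + 1 ≤ h s) ∧
      ∀ u, u < s → ¬ (t₀ ≤ u ∧ u ≤ s₁ ∧ g + 1 ≤ h u) :=
    ⟨Nat.find hex, Nat.find_spec hex, fun u hu => Nat.find_min hex hu⟩
  have hst₀ : s ≠ t₀ := by rintro rfl; omega
  obtain ⟨t, rfl⟩ : ∃ t, s = t + 1 := ⟨s - 1, by omega⟩
  have ht : h t ≤ g := by
    have := hmin t (Nat.lt_succ_self t)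
    simp only [not_and, not_le] at this
    have := this (by omega) (by omega)
    omega
  have hs := hstep t (by omega)
  rw [abs_le] at hs
  exact ⟨t, by omega, by omega, by omega, by omega⟩

/-- First down-crossing of the gap `{g, g+1}` after `t₀` (±1-Lipschitz integer sequence). [folklore] -/
private theorem downcrossTw {h : ℕ → ℤ} {k : ℕ} (hstep : ∀ t, t < k → |h (t + 1) - h t| ≤ 1)
    {t₀ s₁ : ℕ} {g : ℤ} (h01 : t₀ ≤ s₁) (hs₁ : s₁ ≤ k) (hhi : g + 1 ≤ h t₀) (hlo : h s₁ ≤ g) :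
    ∃ t, t₀ ≤ t ∧ t < s₁ ∧ h t = g + 1 ∧ h (t + 1) = g := by
  classical
  have hex : ∃ s, t₀ ≤ s ∧ s ≤ s₁ ∧ h s ≤ g := ⟨s₁, h01, le_rfl, hlo⟩
  obtain ⟨s, ⟨hs0, hss₁, hsg⟩, hmin⟩ : ∃ s, (t₀ ≤ s ∧ s ≤ s₁ ∧ h s ≤ g) ∧
      ∀ u, u < s → ¬ (t₀ ≤ u ∧ u ≤ s₁ ∧ h u ≤ g) :=
    ⟨Nat.find hex, Nat.find_spec hex, fun u hu => Nat.find_min hex hu⟩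
  have hst₀ : s ≠ t₀ := by rintro rfl; omega
  obtain ⟨t, rfl⟩ : ∃ t, s = t + 1 := ⟨s - 1, by omega⟩
  have ht : g + 1 ≤ h t := by
    have := hmin t (Nat.lt_succ_self t)
    simp only [not_and, not_le] at this
    have := this (by omega) (by omega)
    omega
  have hs := hstep t (by omega)
  rw [abs_le] at hs
  exact ⟨t, by omega, by omega, by omega, by omega⟩

/-! ### The theorem -/

/-- ★★ **Two slacks.** An irreducible bridge `ω` of `ℤ^{d+1}` with span `A ≥ 2` and length `k = 3A + 2` has exactly four transverse
steps, and either (i) its height word is the reduced staple word `stapleR A` read at the reduced positions `t − #(flats before t)`,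
two of the flats sitting at the reduced positions `A` and `2A − 1` (the turn plateaus), or (ii) for some `2 ≤ P ≤ A − 1` its flats are
exactly `{P, 2P, 2P + A, P + 2A + 1}` and its height word is the reduced bump word `bumpR A P` read the same way.
[cite: MadrasSlade1993, §4.2, remark after Theorem 4.2.4 (p. 94)] -/
theorem heights_of_length_eq_three_mul_span_add_two (d : ℕ) {A k : ℕ} {ω : ℕ → Site (d + 1)}
    (hω : ω ∈ irreducibleBridges (d + 1) k) (hA2 : 2 ≤ A) (hAk : ω k 0 = A) (hk : k = 3 * A + 2) :
    (flatTimes k ω).card = 4 ∧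
    ((∀ t, t ≤ k → ω t 0 = stapleR A (t - ((flatTimes k ω).filter (· < t)).card)) ∧
        (∃ τ ∈ flatTimes k ω, (τ : ℤ) = A + (((flatTimes k ω).filter (· < τ)).card : ℕ)) ∧
        (∃ τ ∈ flatTimes k ω, (τ : ℤ) = 2 * A - 1 + (((flatTimes k ω).filter (· < τ)).card : ℕ))
      ∨ ∃ P : ℕ, 2 ≤ P ∧ P + 1 ≤ A ∧ flatTimes k ω = {P, 2 * P, 2 * P + A, P + 2 * A + 1} ∧
          ∀ t, t ≤ k → ω t 0 = bumpR A P (t - ((flatTimes k ω).filter (· < t)).card)) := by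
  classical
  obtain ⟨hb, hk1, hbr, hirr⟩ := mem_irreducibleBridges.1 hω
  obtain ⟨hωs, -⟩ := mem_bridges.1 hb
  obtain ⟨hω0, -, hadj, hinj⟩ := mem_saws.1 hωs
  -- heights
  set h : ℕ → ℤ := fun t => ω t 0 with hh
  have h0 : h 0 = 0 := by simp only [hh, hω0]; rfl
  have hA : h k = A := hAk
  have hstep : ∀ t, t < k → |h (t + 1) - h t| ≤ 1 := fun t ht => abs_sub_le_one_of_adj (hadj t ht) 0
  have hpos : ∀ i, 1 ≤ i → i ≤ k → 0 < h i ∧ h i ≤ h k := fun i hi1 hi2 => by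
    have := hbr i hi1 hi2
    rw [hω0] at this
    exact this
  have h1 : h 1 = 1 := by
    have := (hpos 1 le_rfl hk1).1
    have hs := hstep 0 hk1
    rw [zero_add, abs_le] at hs
    omega
  -- no step pair up-down or down-up (self-avoidance)
  have hmem : ∀ i : ℕ, i ≤ k → i ∈ {j : ℕ | j ≤ k} := fun i hi => hi
  have no_ud : ∀ t, t + 2 ≤ k → h (t + 1) = h t + 1 → h (t + 2) = h (t + 1) - 1 → False := by
    intro t ht hu hd'
    have he : ω (t + 2) = ω t := by
      rw [eq_sub_e0_of_adj d (hadj (t + 1) (by omega)) hd', eq_add_e0_of_adj d (hadj t (by omega)) hu, add_sub_cancel_right]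
    have := hinj (hmem (t + 2) ht) (hmem t (by omega)) he
    omega
  have no_du : ∀ t, t + 2 ≤ k → h (t + 1) = h t - 1 → h (t + 2) = h (t + 1) + 1 → False := by
    intro t ht hd' hu
    have he : ω (t + 2) = ω t := by
      rw [eq_add_e0_of_adj d (hadj (t + 1) (by omega)) hu, eq_sub_e0_of_adj d (hadj t (by omega)) hd', sub_add_cancel]
    have := hinj (hmem (t + 2) ht) (hmem t (by omega)) he
    omega
  -- crossing times of the gap `{g, g+1}`
  set C : ℤ → Finset ℕ := fun g => (range k).filter fun t =>
    (h t = g ∧ h (t + 1) = g + 1) ∨ (h t = g + 1 ∧ h (t + 1) = g) with hC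
  have hmemC : ∀ {g : ℤ} {t : ℕ}, t ∈ C g ↔ t < k ∧ ((h t = g ∧ h (t + 1) = g + 1) ∨ (h t = g + 1 ∧ h (t + 1) = g)) := by
    intro g t
    simp only [hC, Finset.mem_filter, Finset.mem_range]
  have hdisj : ∀ g g' : ℤ, g ≠ g' → Disjoint (C g) (C g') := by
    intro g g' hne
    rw [Finset.disjoint_left]
    intro t ht ht'
    rw [hmemC] at ht ht'
    omega
  have hC0 : 1 ≤ (C 0).card := by
    have : 0 ∈ C 0 := by rw [hmemC]; exact ⟨hk1, Or.inl ⟨h0, by rw [h1]; norm_num⟩⟩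
    exact Finset.card_pos.2 ⟨0, this⟩
  -- an internal gap is crossed up, then down, then up again
  have hcross3 : ∀ g : ℤ, 1 ≤ g → g + 1 ≤ A →
      ∃ t₁ td t₂ : ℕ, t₁ < td ∧ td < t₂ ∧ t₂ < k ∧ h t₁ = g ∧ h (t₁ + 1) = g + 1 ∧ h td = g + 1 ∧ h (td + 1) = g ∧
        h t₂ = g ∧ h (t₂ + 1) = g + 1 := by
    intro g hg1 hgA
    have hex : ∃ s, g + 1 ≤ h s ∧ s ≤ k := ⟨k, by rw [hA]; exact hgA, le_rfl⟩
    obtain ⟨s₀, ⟨hs₀g, hs₀k⟩, hs₀min⟩ : ∃ s, (g + 1 ≤ h s ∧ s ≤ k) ∧ ∀ u, u < s → ¬ (g + 1 ≤ h u ∧ u ≤ k) :=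
      ⟨Nat.find hex, Nat.find_spec hex, fun u hu => Nat.find_min hex hu⟩
    have hs₀0 : s₀ ≠ 0 := by rintro rfl; rw [h0] at hs₀g; omega
    obtain ⟨t₁, rfl⟩ : ∃ t, s₀ = t + 1 := ⟨s₀ - 1, by omega⟩
    have hbelow : ∀ u, u ≤ t₁ → h u ≤ g := by
      intro u hu
      have := hs₀min u (by omega)
      simp only [not_and, not_le] at this
      by_contra hcon
      exact absurd (this (by omega)) (by omega)
    have ht₁g : h t₁ = g := by
      have hs := hstep t₁ (by omega)
      rw [abs_le] at hs
      have := hbelow t₁ le_rfl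
      omega
    have ht₁g1 : h (t₁ + 1) = g + 1 := by
      have hs := hstep t₁ (by omega)
      rw [abs_le] at hs
      omega
    have ht₁1 : 1 ≤ t₁ := by
      by_contra h00
      have : t₁ = 0 := by omega
      rw [this, h0] at ht₁g
      omega
    have ht₁k : t₁ < k := by omega
    have hback : ∃ s, t₁ + 1 ≤ s ∧ s ≤ k ∧ h s ≤ g := by
      by_contra hno
      simp only [not_exists, not_and, not_le] at hno
      refine hirr t₁ ht₁1 (by omega) ⟨ht₁k.le, ?_, ?_⟩
      · intro i hi1 hi2
        refine ⟨(hpos i hi1 (by omega)).1 |> fun h' => by rw [hω0]; exact h', ?_⟩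
        show h i ≤ h t₁
        rw [ht₁g]; exact hbelow i hi2
      · intro j hj1 hj2
        refine ⟨?_, ?_⟩
        · show h (t₁ + 0) < h (t₁ + j)
          rw [add_zero, ht₁g]
          have := hno (t₁ + j) (by omega) (by omega)
          omega
        · show h (t₁ + j) ≤ h (t₁ + (k - t₁))
          rw [show t₁ + (k - t₁) = k by omega]
          exact (hpos (t₁ + j) (by omega) (by omega)).2
    obtain ⟨s, hs1, hsk, hsg⟩ := hback
    obtain ⟨td, htd1, htds, htdg1, htdg⟩ :=
      downcrossTw (g := g) (t₀ := t₁ + 1) (s₁ := s) hstep hs1 hsk (by rw [ht₁g1]) hsg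
    obtain ⟨t₂, ht₂1, ht₂k, ht₂g, ht₂g1⟩ :=
      upcrossTw (g := g) (t₀ := td + 1) (s₁ := k) hstep (show td + 1 ≤ k by omega) le_rfl (by rw [htdg]) (by rw [hA]; exact hgA)
    exact ⟨t₁, td, t₂, by omega, by omega, ht₂k, ht₁g, ht₁g1, htdg1, htdg, ht₂g, ht₂g1⟩
  have hC3 : ∀ g : ℤ, 1 ≤ g → g + 1 ≤ A → 3 ≤ (C g).card := by
    intro g hg1 hgA
    obtain ⟨t₁, td, t₂, h12, h23, ht₂k, ht₁g, ht₁g1, htdg1, htdg, ht₂g, ht₂g1⟩ := hcross3 g hg1 hgA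
    have hsub : ({t₁, td, t₂} : Finset ℕ) ⊆ C g := by
      intro t ht
      simp only [Finset.mem_insert, Finset.mem_singleton] at ht
      rw [hmemC]
      rcases ht with rfl | rfl | rfl
      · exact ⟨by omega, Or.inl ⟨ht₁g, ht₁g1⟩⟩
      · exact ⟨by omega, Or.inr ⟨htdg1, htdg⟩⟩
      · exact ⟨ht₂k, Or.inl ⟨ht₂g, ht₂g1⟩⟩
    have hcard : ({t₁, td, t₂} : Finset ℕ).card = 3 := by
      rw [Finset.card_eq_three]
      exact ⟨t₁, td, t₂, by omega, by omega, by omega, rfl⟩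
    calc 3 = ({t₁, td, t₂} : Finset ℕ).card := hcard.symm
      _ ≤ (C g).card := Finset.card_le_card hsub
  -- the down-steps; the first and the last one are flanked by transverse steps
  set D : Finset ℕ := (range k).filter fun t => h (t + 1) = h t - 1 with hD
  have hmemD : ∀ {t : ℕ}, t ∈ D ↔ t < k ∧ h (t + 1) = h t - 1 := by
    intro t; simp only [hD, Finset.mem_filter, Finset.mem_range]
  obtain ⟨t₁', td', t₂', -, h23', ht₂k', -, -, htdg1', htdg', -, -⟩ := hcross3 1 le_rfl (by exact_mod_cast hA2)
  have htd'D : td' ∈ D := hmemD.2 ⟨by omega, by rw [htdg', htdg1']; ring⟩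
  have hDne : D.Nonempty := ⟨td', htd'D⟩
  set tm := D.min' hDne with htm
  set tM := D.max' hDne with htM
  have htmD : tm ∈ D := Finset.min'_mem D hDne
  have htMD : tM ∈ D := Finset.max'_mem D hDne
  obtain ⟨htmk, htmd⟩ := hmemD.1 htmD
  obtain ⟨htMk, htMd⟩ := hmemD.1 htMD
  have hDmin : ∀ t, t ∈ D → tm ≤ t := fun t ht => by rw [htm]; exact Finset.min'_le D t ht
  have hDmax : ∀ t, t ∈ D → t ≤ tM := fun t ht => by rw [htM]; exact Finset.le_max' D t ht
  have htm1 : 1 ≤ tm := by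
    by_contra h00
    have : tm = 0 := by omega
    rw [this, zero_add, h1, h0] at htmd
    omega
  obtain ⟨τ₁, hτ₁⟩ : ∃ τ, tm = τ + 1 := ⟨tm - 1, by omega⟩
  have hτ₁flat : h (τ₁ + 1) = h τ₁ := by
    have hs := hstep τ₁ (by omega)
    rw [abs_le] at hs
    rcases lt_trichotomy (h (τ₁ + 1)) (h τ₁) with hlt | heq | hgt
    · have := hDmin τ₁ (hmemD.2 ⟨by omega, by omega⟩)
      omega
    · exact heq
    · exact (no_ud τ₁ (by omega) (by omega) (by rw [show τ₁ + 2 = tm + 1 by omega, show τ₁ + 1 = tm by omega]; exact htmd)).elim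
  have hτ₁1 : 1 ≤ τ₁ := by
    by_contra h00
    have : τ₁ = 0 := by omega
    rw [this, zero_add, h1, h0] at hτ₁flat
    omega
  have htMk2 : tM + 2 ≤ k := by
    by_contra hcon
    have : tM + 1 = k := by omega
    have hle : h tM ≤ h k := (hpos tM (by
      by_contra h00
      have h00' : tM = 0 := by omega
      rw [h00', zero_add, h1, h0] at htMd; omega) htMk.le).2
    rw [← this] at hle
    omega
  have hτ₂flat : h (tM + 1 + 1) = h (tM + 1) := by
    have hs := hstep (tM + 1) (by omega)
    rw [abs_le] at hs
    rcases lt_trichotomy (h (tM + 1 + 1)) (h (tM + 1)) with hlt | heq | hgt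
    · have := hDmax (tM + 1) (hmemD.2 ⟨by omega, by omega⟩)
      omega
    · exact heq
    · exact (no_du tM htMk2 htMd (by rw [show tM + 2 = tM + 1 + 1 from rfl]; omega)).elim
  have hτlt : τ₁ < tM := by
    have := hDmin tM htMD
    omega
  -- COUNT: the crossing times of the gaps `0, …, A−1` are `≥ 3A − 2` of the `3A + 2` times; so at most four flat steps
  set F : Finset ℕ := flatTimes k ω with hFdef
  have hmemF : ∀ {t : ℕ}, t ∈ F ↔ t < k ∧ h (t + 1) = h t := by
    intro t; simp only [hFdef, flatTimes, Finset.mem_filter, Finset.mem_range, hh]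
  have hFsub : F ⊆ range k := by rw [hFdef]; exact Finset.filter_subset _ _
  have hτ₁F : τ₁ ∈ F := hmemF.2 ⟨by omega, hτ₁flat⟩
  have hτ₂F : (tM + 1) ∈ F := hmemF.2 ⟨by omega, hτ₂flat⟩
  set U : Finset ℕ := (range A).biUnion fun i : ℕ => C (i : ℤ) with hU'
  have hU : U ⊆ range k := by
    intro t ht
    obtain ⟨i, -, hi⟩ := Finset.mem_biUnion.1 ht
    rw [hmemC] at hi
    exact Finset.mem_range.2 hi.1
  have hUF : Disjoint U F := by
    rw [hU', Finset.disjoint_biUnion_left]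
    intro i _
    rw [Finset.disjoint_left]
    intro t htC htF
    rw [hmemC] at htC
    rw [hmemF] at htF
    omega
  have hsumU : U.card = ∑ i ∈ range A, (C (i : ℤ)).card := by
    rw [hU', Finset.card_biUnion]
    intro i _ j _ hij
    exact hdisj _ _ (by exact_mod_cast hij)
  have hlow : 3 * A - 2 ≤ U.card := by
    rw [hsumU]
    obtain ⟨M, rfl⟩ : ∃ M, A = M + 1 := ⟨A - 1, by omega⟩
    rw [Finset.sum_range_succ']
    have h3 : 3 * M ≤ ∑ i ∈ range M, (C ((i + 1 : ℕ) : ℤ)).card := by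
      calc 3 * M = ∑ i ∈ range M, 3 := by simp [mul_comm]
        _ ≤ ∑ i ∈ range M, (C ((i + 1 : ℕ) : ℤ)).card :=
            Finset.sum_le_sum fun i hi => by
              have hi' := Finset.mem_range.1 hi
              exact hC3 _ (by push_cast; omega) (by push_cast; omega)
    have h1' : 1 ≤ (C ((0 : ℕ) : ℤ)).card := by simpa using hC0
    omega
  have hFcard : F.card ≤ 4 := by
    have h' : (U ∪ F).card ≤ (range k).card := Finset.card_le_card (Finset.union_subset hU hFsub)
    rw [Finset.card_union_of_disjoint hUF, Finset.card_range] at h'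
    omega
  -- flat steps are flat, the others vertical; no down-step before `tm` or after `tM`
  have hflat : ∀ t, t ∈ F → h (t + 1) = h t := fun t ht => (hmemF.1 ht).2
  have hvert : ∀ t, t < k → t ∉ F → h (t + 1) = h t + 1 ∨ h (t + 1) = h t - 1 := by
    intro t htk htF
    rw [hmemF] at htF
    have hs := hstep t htk
    rw [abs_le] at hs
    omega
  have hnodown1 : ∀ t, t < tm → h (t + 1) ≠ h t - 1 := by
    intro t ht hd'
    have := hDmin t (hmemD.2 ⟨by omega, hd'⟩)
    omega
  have hnodown3 : ∀ t, tM < t → t < k → h (t + 1) ≠ h t - 1 := by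
    intro t ht htk hd'
    have := hDmax t (hmemD.2 ⟨htk, hd'⟩)
    omega
  have hpos' : ∀ t, 1 ≤ t → t ≤ k → 1 ≤ h t ∧ h t ≤ A := fun t ht1 ht2 => by
    have := hpos t ht1 ht2; rw [hA] at this; exact ⟨by omega, this.2⟩
  by_cases hcase : ∃ u, tm < u ∧ u < tM ∧ h (u + 1) = h u + 1
  · -- REGIME (ii): an up-step inside `[tm, tM]` — two descents, four turns, four flats
    obtain ⟨u, htmu, hutM, hu⟩ := hcase
    set D1 := D.filter (· < u) with hD1
    have hD1ne : D1.Nonempty := ⟨tm, Finset.mem_filter.2 ⟨htmD, htmu⟩⟩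
    set d1 := D1.max' hD1ne with hd1
    obtain ⟨hd1D, hd1u⟩ := Finset.mem_filter.1 (Finset.max'_mem D1 hD1ne)
    have hd1max : ∀ t, t ∈ D → t < u → t ≤ d1 := fun t ht htu => by
      rw [hd1]; exact Finset.le_max' D1 t (Finset.mem_filter.2 ⟨ht, htu⟩)
    set D2 := D.filter (u < ·) with hD2
    have hD2ne : D2.Nonempty := ⟨tM, Finset.mem_filter.2 ⟨htMD, hutM⟩⟩
    set d2 := D2.min' hD2ne with hd2
    obtain ⟨hd2D, hud2⟩ := Finset.mem_filter.1 (Finset.min'_mem D2 hD2ne)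
    have hd2min : ∀ t, t ∈ D → u < t → d2 ≤ t := fun t ht htu => by
      rw [hd2]; exact Finset.min'_le D2 t (Finset.mem_filter.2 ⟨ht, htu⟩)
    obtain ⟨hd1k, hd1d⟩ := hmemD.1 hd1D
    obtain ⟨hd2k, hd2d⟩ := hmemD.1 hd2D
    have htmd1 : tm ≤ d1 := hDmin d1 hd1D
    have hd2tM : d2 ≤ tM := hDmax d2 hd2D
    -- the flats `φ₁ = d1 + 1` and `φ₂ = d2 − 1`
    have hφ1u : d1 + 1 < u := by
      rcases (show d1 + 1 = u ∨ d1 + 1 < u by omega) with he | hl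
      · exact (no_du d1 (by omega) hd1d (by rw [show d1 + 2 = u + 1 by omega, he]; exact hu)).elim
      · exact hl
    have hφ1F : d1 + 1 ∈ F := by
      by_contra hnF
      rcases hvert (d1 + 1) (by omega) hnF with hup | hdn
      · exact no_du d1 (by omega) hd1d (by rw [show d1 + 2 = d1 + 1 + 1 by ring]; exact hup)
      · have := hd1max (d1 + 1) (hmemD.2 ⟨by omega, hdn⟩) hφ1u
        omega
    have huφ2 : u < d2 - 1 := by
      rcases (show u + 1 = d2 ∨ u + 1 < d2 by omega) with he | hl
      · exact (no_ud u (by omega) hu (by rw [show u + 2 = d2 + 1 by omega, show u + 1 = d2 by omega]; exact hd2d)).elim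
      · omega
    have hφ2F : d2 - 1 ∈ F := by
      by_contra hnF
      rcases hvert (d2 - 1) (by omega) hnF with hup | hdn
      · exact no_ud (d2 - 1) (by omega) hup (by
          rw [show d2 - 1 + 2 = d2 + 1 by omega, show d2 - 1 + 1 = d2 by omega]; exact hd2d)
      · have := hd2min (d2 - 1) (hmemD.2 ⟨by omega, hdn⟩) (by omega)
        omega
    -- hence `F = {τ₁, d1 + 1, d2 − 1, tM + 1}`
    have hsub4 : ({τ₁, d1 + 1, d2 - 1, tM + 1} : Finset ℕ) ⊆ F := by
      intro t ht
      simp only [Finset.mem_insert, Finset.mem_singleton] at ht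
      rcases ht with rfl | rfl | rfl | rfl
      · exact hτ₁F
      · exact hφ1F
      · exact hφ2F
      · exact hτ₂F
    have hcard4 : ({τ₁, d1 + 1, d2 - 1, tM + 1} : Finset ℕ).card = 4 := by
      rw [Finset.card_insert_of_notMem, Finset.card_insert_of_notMem, Finset.card_insert_of_notMem, Finset.card_singleton]
      · simp only [Finset.mem_singleton]; omega
      · simp only [Finset.mem_insert, Finset.mem_singleton]; omega
      · simp only [Finset.mem_insert, Finset.mem_singleton]; omega
    have hFeq : F = {τ₁, d1 + 1, d2 - 1, tM + 1} :=
      (Finset.eq_of_subset_of_card_le hsub4 (by rw [hcard4]; exact hFcard)).symm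
    have hnotF : ∀ t, t ≠ τ₁ → t ≠ d1 + 1 → t ≠ d2 - 1 → t ≠ tM + 1 → t ∉ F := by
      intro t h1' h2' h3' h4' ht
      rw [hFeq] at ht
      simp only [Finset.mem_insert, Finset.mem_singleton] at ht
      omega
    -- the five runs
    have hr1 : ∀ t, t < τ₁ → h (t + 1) = h t + 1 := by
      intro t ht
      rcases hvert t (by omega) (hnotF t (by omega) (by omega) (by omega) (by omega)) with hup | hdn
      · exact hup
      · exact absurd hdn (hnodown1 t (by omega))
    have hr2 : ∀ t, τ₁ < t → t < d1 + 1 → h (t + 1) = h t - 1 := by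
      intro t ht1 ht2
      refine down_run (a := tm) (b := d1) (fun s hs1 hs2 => hvert s (by omega)
        (hnotF s (by omega) (by omega) (by omega) (by omega))) (fun s hs1 hs2 hd hu' => no_du s (by omega) hd hu')
        htmd t (by omega) (by omega)
    have hr3 : ∀ t, d1 + 1 < t → t < d2 - 1 → h (t + 1) = h t + 1 := by
      intro t ht1 ht2
      rcases hvert t (by omega) (hnotF t (by omega) (by omega) (by omega) (by omega)) with hup | hdn
      · exact hup
      · exfalso
        have htD : t ∈ D := hmemD.2 ⟨by omega, hdn⟩
        rcases lt_trichotomy t u with hl | rfl | hg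
        · have := hd1max t htD hl; omega
        · omega
        · have := hd2min t htD hg; omega
    have hr4 : ∀ t, d2 - 1 < t → t ≤ tM → h (t + 1) = h t - 1 := by
      intro t ht1 ht2
      refine down_run (a := d2) (b := tM) (fun s hs1 hs2 => hvert s (by omega)
        (hnotF s (by omega) (by omega) (by omega) (by omega))) (fun s hs1 hs2 hd hu' => no_du s (by omega) hd hu')
        hd2d t (by omega) ht2
    have hr5 : ∀ t, tM + 1 < t → t < k → h (t + 1) = h t + 1 := by
      intro t ht htk
      rcases hvert t htk (hnotF t (by omega) (by omega) (by omega) (by omega)) with hup | hdn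
      · exact hup
      · exact absurd hdn (hnodown3 t (by omega) htk)
    have hcov : ∀ g : ℤ, 1 ≤ g → g + 1 ≤ A → ∃ t, t < k ∧ h t = g + 1 ∧ h (t + 1) = g := by
      intro g hg1 hgA
      obtain ⟨-, td, t₂, -, h23, ht₂k, -, -, htdg1, htdg, -, -⟩ := hcross3 g hg1 hgA
      exact ⟨td, by omega, htdg1, htdg⟩
    obtain ⟨hP2, hPA, hFP, hword⟩ := regime_two (h := h) (F := F) hk hFeq (by omega) (by omega) (by omega) htMk2 hflat
      hr1 hr2 hr3 hr4 hr5 h0 hA hpos' hcov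
    refine ⟨by rw [hFeq, hcard4], Or.inr ⟨τ₁, hP2, hPA, hFP, fun t ht => hword t ht⟩⟩
  · -- REGIME (i): no up-step inside `[tm, tM]` — one descent
    have hcase' : ∀ u, tm < u → u < tM → h (u + 1) ≠ h u + 1 := by
      intro u h1' h2' h3'; exact hcase ⟨u, h1', h2', h3'⟩
    have hr1 : ∀ t, t ≤ τ₁ → t ∉ F → h (t + 1) = h t + 1 := by
      intro t ht htF
      rcases hvert t (by omega) htF with hup | hdn
      · exact hup
      · exact absurd hdn (hnodown1 t (by omega))
    have hr2 : ∀ t, τ₁ + 1 ≤ t → t ≤ tM → t ∉ F → h (t + 1) = h t - 1 := by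
      intro t ht1 ht2 htF
      rcases hvert t (by omega) htF with hup | hdn
      · exfalso
        rcases (show t = tm ∨ t = tM ∨ (tm < t ∧ t < tM) by omega) with rfl | rfl | ⟨hl, hg⟩
        · omega
        · omega
        · exact hcase' t hl hg hup
      · exact hdn
    have hr3 : ∀ t, tM + 1 ≤ t → t < k → t ∉ F → h (t + 1) = h t + 1 := by
      intro t ht htk htF
      have hne : t ≠ tM + 1 := by rintro rfl; exact htF hτ₂F
      rcases hvert t htk htF with hup | hdn
      · exact hup
      · exact absurd hdn (hnodown3 t (by omega) htk)
    obtain ⟨hF4, hword, hpA, hvA⟩ := regime_one (h := h) (F := F) hA2 hk hFsub hFcard hτ₁F hτ₂F hτlt htMk2 hflat hr1 hr2 hr3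
      h0 hA (hpos' τ₁ (by omega) (by omega)).2 (hpos' (tM + 1) (by omega) (by omega)).1
    exact ⟨hF4, Or.inl ⟨fun t ht => hword t ht, ⟨τ₁, hτ₁F, hpA⟩, ⟨tM + 1, hτ₂F, by push_cast; linarith⟩⟩⟩

end Literature.Probability.RandomPlanarGeometry.SAW.Zd

end
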